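import Mathlib.Analysis.SpecialFunctions.Pow.Asymptotics
import Mathlib.Analysis.Complex.ExponentialBounds
import Literature.NumberTheory.LFunctions.GaussianHeckeNonvanishing
import HarnessLib

/-!
# A Vinogradov–Korobov (Coleman) zero-free region for the Hecke `L`-functions of `ℚ(i)`: the interface

Topic `Literature/NumberTheory/LFunctions`.  This file introduces ONE definition — a PREDICATE, not a
named fact — and proves its consequences at a fixed scale:

* `GaussianHecke.HasVKZeroFreeRegion c V₀` — for the continued Dirichlet series `D_m = 4 L(·, λ^m)` of the
  angular characters `λ^m(z) = (z/|z|)^{4m}` of `ℤ[i]` (`Literature.NumberTheory.LFunctions.GaussianHecke.heckeL`):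
  **for `m ≥ 1` and `V = m + |Im s| + 3 ≥ V₀`, `D_m(s) ≠ 0` whenever
  `Re s ≥ 1 - c / ((log V)^{2/3} (log log V)^{1/3})`.**  This is the shape of M. D. Coleman's theorem
  (*A zero-free region for the Hecke `L`-functions*, Mathematika 37 (1990), 287–304, Theorem 2; restated as
  Theorem 2.5 of arXiv:2008.09677 and in §12.6 of arXiv:2111.05403): for the Grössencharaktere `λ^𝐦 μ` of
  a number field `K` and `V = V(𝐦, t)` sufficiently large, `L(σ + it, λ^𝐦 μ) ≠ 0` for
  `σ ≥ 1 - A / max(log N𝔣, (log V)^{2/3}(log log V)^{1/3})`, apart from a possible exceptional real zero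
  when `𝐦 = 0` and `μ` is real.  For `K = ℚ(i)`, conductor `𝔣 = 1` and `𝐦 ≠ 0` (our `m ≥ 1`) there is no
  exceptional zero, `V(𝐦, t) ≤ 4(m + |t| + 3)` and the width is decreasing in `V`, so Coleman's theorem
  gives `∃ c > 0, ∃ V₀, HasVKZeroFreeRegion c V₀`; every consumer below and in the sequel is proved in the
  form `…_of_vk (hc : 0 < c) (hVK : HasVKZeroFreeRegion c V₀)` — any constant, any threshold — exactly as
  the tree does for Dirichlet `L`-functions (`Literature.NumberTheory.LFunctions.HasVKZeroFreeRegion`,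
  `VinogradovKorobovDirichlet.lean`).  Coleman's theorem itself (Vinogradov's method over `K`) is NOT in
  the tree and is not asserted here.
* `GaussianHecke.exists_width_of_le` — PROVED: the bounded range is harmless: for every `V₀` there is
  `δ₀ > 0` with `D_m(s) ≠ 0` for `1 ≤ m ≤ V₀`, `|Im s| ≤ V₀`, `Re s ≥ 1 - δ₀` (non-vanishing on `Re s ≥ 1`,
  `GaussianHeckeNonvanishing.lean`, continuity and compactness — finitely many entire functions).
* `GaussianHecke.eventually_zeroFree_of_vk` — PROVED: **at scale `Q`**, for all large `Q`, every
  `1 ≤ m ≤ Q` and `|Im z| ≤ 2Q²`: `D_m(z) ≠ 0` for `Re z ≥ 1 - c/((log 4Q²)^{2/3}(log log 4Q²)^{1/3})`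
  (the width at `V = 4Q² ≥ m + |Im z| + 3`, monotonicity, and `exists_width_of_le` below `V₀`).

## References

* M. D. Coleman, *A zero-free region for the Hecke L-functions*, Mathematika 37 (1990), 287–304, Thm 2.
  [ColemanMathematika1990]
* G. Harman, *Prime-Detecting Sieves*, Princeton UP 2007, §11.4, Lemma 11.6 and ref. [23] (the consumer).
  [Harman2007]
-/

noncomputable section

open Complex Filter Topology Set

namespace Literature.NumberTheory.LFunctions

namespace GaussianHecke

/-- **Vinogradov–Korobov / Coleman zero-free region for `L(s, λ^m)`, `m ≥ 1`, as a predicate** in the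
constant `c` and the threshold `V₀`: with `V = m + |Im s| + 3`, for `V ≥ V₀`,
`D_m(s) ≠ 0` whenever `Re s ≥ 1 - c / ((log V)^{2/3} (log log V)^{1/3})`.
(Coleman 1990, Thm 2, for `K = ℚ(i)`, `𝔣 = 1`, `λ^m` with `m ≠ 0`, is `∃ c > 0, ∃ V₀, HasVKZeroFreeRegion c V₀`;
a DEFINITION — the theorem is not asserted.) [cite: ColemanMathematika1990, Theorem 2] -/
def HasVKZeroFreeRegion (c V₀ : ℝ) : Prop :=
  ∀ (m : ℕ) (s : ℂ), 1 ≤ m → V₀ ≤ (m : ℝ) + |s.im| + 3 →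
    1 - c / (Real.log ((m : ℝ) + |s.im| + 3) ^ (2 / 3 : ℝ) *
        Real.log (Real.log ((m : ℝ) + |s.im| + 3)) ^ (1 / 3 : ℝ)) ≤ s.re →
      heckeL m s ≠ 0

/-! ### The bounded range: compactness -/

/-- For a fixed `m ≥ 1` and `V₀`: some strip `1 - δ ≤ Re s`, `|Im s| ≤ V₀` is free of zeros of `D_m`
(if not, zeros `s_n` with `Re s_n → 1⁻` accumulate, by compactness, at a zero on `Re s = 1`, contradicting
`heckeL_ne_zero_of_one_le_re`). [folklore] -/
theorem exists_width_fixed {m : ℕ} (hm : m ≠ 0) (V₀ : ℝ) :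
    ∃ δ : ℝ, 0 < δ ∧ ∀ s : ℂ, |s.im| ≤ V₀ → 1 - δ ≤ s.re → heckeL m s ≠ 0 := by
  by_contra hcon
  push Not at hcon
  -- a sequence of zeros with `1 - 1/(n+1) ≤ Re s_n`
  have hseq : ∀ n : ℕ, ∃ s : ℂ, |s.im| ≤ V₀ ∧ 1 - 1 / ((n : ℝ) + 1) ≤ s.re ∧ heckeL m s = 0 := by
    intro n
    obtain ⟨s, hs1, hs2, hs3⟩ := hcon (1 / ((n : ℝ) + 1)) (by positivity)
    exact ⟨s, hs1, hs2, hs3⟩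
  choose s hs using hseq
  have hre1 : ∀ n, (s n).re < 1 := fun n ↦ by
    by_contra h
    exact heckeL_ne_zero_of_one_le_re hm (not_lt.mp h) (hs n).2.2
  -- all in the compact rectangle `[0, 1] × [-V₀, V₀]`
  have hK : IsCompact (Icc (0 : ℝ) 1 ×ℂ Icc (-V₀) V₀) := isCompact_Icc.reProdIm isCompact_Icc
  have hmem : ∀ n, s n ∈ Icc (0 : ℝ) 1 ×ℂ Icc (-V₀) V₀ := fun n ↦ by
    refine ⟨⟨?_, (hre1 n).le⟩, abs_le.mp (hs n).1⟩
    have h1 : (0 : ℝ) ≤ 1 - 1 / ((n : ℝ) + 1) := by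
      rw [sub_nonneg, div_le_one (by positivity)]; linarith
    exact h1.trans (hs n).2.1
  obtain ⟨a, -, φ, hφ, hlim⟩ := hK.tendsto_subseq hmem
  -- the limit is a zero …
  have hzero : heckeL m a = 0 := by
    have hcl : IsClosed {z : ℂ | heckeL m z = 0} :=
      isClosed_eq (differentiable_heckeL hm).continuous continuous_const
    exact hcl.mem_of_tendsto hlim (Eventually.of_forall fun n ↦ (hs (φ n)).2.2)
  -- … on the line `Re s = 1`
  have hre : 1 ≤ a.re := by
    have h1 : Tendsto (fun n ↦ (s (φ n)).re) atTop (𝓝 a.re) :=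
      (Complex.continuous_re.tendsto a).comp hlim
    have h2 : Tendsto (fun n : ℕ ↦ 1 - 1 / ((φ n : ℝ) + 1)) atTop (𝓝 (1 - 0)) := by
      refine tendsto_const_nhds.sub ?_
      have hφ' : Tendsto (fun n : ℕ ↦ (φ n : ℝ) + 1) atTop atTop :=
        tendsto_atTop_add_const_right _ _
          (tendsto_natCast_atTop_atTop.comp hφ.tendsto_atTop)
      exact tendsto_const_nhds.div_atTop hφ'
    rw [sub_zero] at h2
    exact le_of_tendsto_of_tendsto' h2 h1 fun n ↦ (hs (φ n)).2.1
  exact heckeL_ne_zero_of_one_le_re hm hre hzero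

/-- **The bounded range is harmless**: for every `V₀` there is `δ₀ > 0` such that `D_m(s) ≠ 0` for all
`1 ≤ m ≤ V₀`, `|Im s| ≤ V₀`, `Re s ≥ 1 - δ₀` (finitely many `m`; `exists_width_fixed`). [folklore] -/
theorem exists_width_of_le (V₀ : ℝ) :
    ∃ δ₀ : ℝ, 0 < δ₀ ∧ ∀ (m : ℕ), 1 ≤ m → (m : ℝ) ≤ V₀ →
      ∀ s : ℂ, |s.im| ≤ V₀ → 1 - δ₀ ≤ s.re → heckeL m s ≠ 0 := by
  classical
  -- a width for every `m` (value `1` at `m = 0`, unused)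
  have hδ : ∀ m : ℕ, ∃ δ : ℝ, 0 < δ ∧ (m ≠ 0 → ∀ s : ℂ, |s.im| ≤ V₀ → 1 - δ ≤ s.re → heckeL m s ≠ 0) := by
    intro m
    rcases eq_or_ne m 0 with rfl | hm
    · exact ⟨1, one_pos, fun h ↦ absurd rfl h⟩
    · obtain ⟨δ, hδ, h⟩ := exists_width_fixed hm V₀
      exact ⟨δ, hδ, fun _ ↦ h⟩
  choose δ hδpos hδ using hδ
  set N : ℕ := ⌊V₀⌋₊ with hN
  set F : Finset ℝ := (Finset.range (N + 1)).image δ with hF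
  have hFne : F.Nonempty := ⟨δ 0, Finset.mem_image.mpr ⟨0, by simp, rfl⟩⟩
  refine ⟨F.min' hFne, ?_, fun m hm1 hmV s hs hre ↦ ?_⟩
  · obtain ⟨k, -, hk⟩ := Finset.mem_image.mp (F.min'_mem hFne)
    rw [← hk]; exact hδpos k
  · have hmN : m ∈ Finset.range (N + 1) := by
      rw [Finset.mem_range, Nat.lt_succ_iff, hN]
      exact Nat.le_floor hmV
    have hle : F.min' hFne ≤ δ m := F.min'_le _ (Finset.mem_image.mpr ⟨m, hmN, rfl⟩)
    exact hδ m (by omega) s hs (by linarith)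

/-! ### The region at scale `Q` -/

/-- The Vinogradov–Korobov denominator `g(V) = (log V)^{2/3} (log log V)^{1/3}` is positive for `V > e`.
[folklore] -/
theorem vkDen_pos {V : ℝ} (hV : Real.exp 1 < V) :
    0 < Real.log V ^ (2 / 3 : ℝ) * Real.log (Real.log V) ^ (1 / 3 : ℝ) := by
  have h0 : 0 < V := lt_trans (Real.exp_pos 1) hV
  have h1 : 1 < Real.log V := by
    rw [Real.lt_log_iff_exp_lt h0]; exact hV
  have h2 : 0 < Real.log (Real.log V) := Real.log_pos h1
  exact mul_pos (Real.rpow_pos_of_pos (by linarith) _) (Real.rpow_pos_of_pos h2 _)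

/-- Monotonicity of the denominator: `g(V) ≤ g(V')` for `e < V ≤ V'`. [folklore] -/
theorem vkDen_mono {V V' : ℝ} (hV : Real.exp 1 < V) (hVV' : V ≤ V') :
    Real.log V ^ (2 / 3 : ℝ) * Real.log (Real.log V) ^ (1 / 3 : ℝ) ≤
      Real.log V' ^ (2 / 3 : ℝ) * Real.log (Real.log V') ^ (1 / 3 : ℝ) := by
  have h0 : 0 < V := lt_trans (Real.exp_pos 1) hV
  have h1 : 1 < Real.log V := by
    rw [Real.lt_log_iff_exp_lt h0]; exact hV
  have hlog : Real.log V ≤ Real.log V' := Real.log_le_log h0 hVV'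
  have h2 : 0 < Real.log (Real.log V) := Real.log_pos h1
  have hloglog : Real.log (Real.log V) ≤ Real.log (Real.log V') := Real.log_le_log (by linarith) hlog
  apply mul_le_mul
  · exact Real.rpow_le_rpow (by linarith) hlog (by norm_num)
  · exact Real.rpow_le_rpow h2.le hloglog (by norm_num)
  · exact Real.rpow_nonneg h2.le _
  · exact Real.rpow_nonneg (by linarith) _

/-- The width `c / g(4Q²)` tends to `0⁺` as `Q → ∞` (`c > 0`). [folklore] -/
theorem tendsto_vkWidth_atTop (c : ℝ) :
    Tendsto (fun Q : ℝ ↦ c / (Real.log (4 * Q ^ 2) ^ (2 / 3 : ℝ) *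
      Real.log (Real.log (4 * Q ^ 2)) ^ (1 / 3 : ℝ))) atTop (𝓝 0) := by
  have h4 : Tendsto (fun Q : ℝ ↦ 4 * Q ^ 2) atTop atTop := by
    refine Tendsto.const_mul_atTop (by norm_num) ?_
    exact (tendsto_pow_atTop (by norm_num : (2 : ℕ) ≠ 0))
  have hlog : Tendsto (fun Q : ℝ ↦ Real.log (4 * Q ^ 2)) atTop atTop := Real.tendsto_log_atTop.comp h4
  have hloglog : Tendsto (fun Q : ℝ ↦ Real.log (Real.log (4 * Q ^ 2))) atTop atTop :=
    Real.tendsto_log_atTop.comp hlog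
  have hg : Tendsto (fun Q : ℝ ↦ Real.log (4 * Q ^ 2) ^ (2 / 3 : ℝ) *
      Real.log (Real.log (4 * Q ^ 2)) ^ (1 / 3 : ℝ)) atTop atTop :=
    ((tendsto_rpow_atTop (by norm_num)).comp hlog).atTop_mul_atTop₀
      ((tendsto_rpow_atTop (by norm_num)).comp hloglog)
  exact tendsto_const_nhds.div_atTop hg

/-- **The zero-free region at scale `Q`, from `HasVKZeroFreeRegion c V₀`** (`c > 0`): for all large `Q`,
every `1 ≤ m ≤ Q` and every `z` with `|Im z| ≤ 2Q²` and
`Re z ≥ 1 - c / ((log 4Q²)^{2/3} (log log 4Q²)^{1/3})` has `D_m(z) ≠ 0`.  (For `V = m + |Im z| + 3 ≥ V₀`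
this is the region at `V ≤ 4Q²` by monotonicity of the width; below `V₀`, `exists_width_of_le`, the width
at scale `Q` being eventually `≤ δ₀(V₀)`.) [cite: ColemanMathematika1990, Theorem 2] -/
theorem eventually_zeroFree_of_vk {c V₀ : ℝ} (hc : 0 < c) (hVK : HasVKZeroFreeRegion c V₀) :
    ∀ᶠ Q : ℝ in atTop, ∀ (m : ℕ), 1 ≤ m → (m : ℝ) ≤ Q → ∀ z : ℂ, |z.im| ≤ 2 * Q ^ 2 →
      1 - c / (Real.log (4 * Q ^ 2) ^ (2 / 3 : ℝ) * Real.log (Real.log (4 * Q ^ 2)) ^ (1 / 3 : ℝ)) ≤ z.re →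
        heckeL m z ≠ 0 := by
  obtain ⟨δ₀, hδ₀, hsmall⟩ := exists_width_of_le V₀
  filter_upwards [eventually_ge_atTop (3 : ℝ), (tendsto_order.1 (tendsto_vkWidth_atTop c)).2 δ₀ hδ₀]
    with Q hQ3 hQδ m hm1 hmQ z hzQ hzre
  set V : ℝ := (m : ℝ) + |z.im| + 3 with hVdef
  have hm1' : (1 : ℝ) ≤ m := by exact_mod_cast hm1
  have he : Real.exp 1 < 4 := by
    have := Real.exp_one_lt_d9; norm_num at this ⊢; linarith
  have hVe : Real.exp 1 < V := by rw [hVdef]; linarith [abs_nonneg z.im]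
  have hVQ : V ≤ 4 * Q ^ 2 := by rw [hVdef]; nlinarith [abs_nonneg z.im]
  rcases le_or_gt V₀ V with hV₀ | hV₀
  · -- the printed region at `V`, which contains the region at scale `Q`
    refine hVK m z hm1 hV₀ (le_trans ?_ hzre)
    have hgV := vkDen_pos hVe
    have hmono := vkDen_mono hVe hVQ
    have : c / (Real.log (4 * Q ^ 2) ^ (2 / 3 : ℝ) * Real.log (Real.log (4 * Q ^ 2)) ^ (1 / 3 : ℝ)) ≤
        c / (Real.log V ^ (2 / 3 : ℝ) * Real.log (Real.log V) ^ (1 / 3 : ℝ)) :=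
      div_le_div_of_nonneg_left hc.le hgV hmono
    rw [hVdef] at this
    linarith
  · -- the bounded range
    have hmV : (m : ℝ) ≤ V₀ := by rw [hVdef] at hV₀; linarith [abs_nonneg z.im]
    have hzV : |z.im| ≤ V₀ := by rw [hVdef] at hV₀; linarith
    exact hsmall m hm1 hmV z hzV (by linarith [hQδ.le])

end GaussianHecke

end Literature.NumberTheory.LFunctions
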